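import Mathlib
import Literature.Barriers.Parity.FordMaynardPrimeSieves

/-!
# Route `FordMaynardSieveConst01651`, target `SieveConst01651` (stmt-Parity-19185), line `sieve_decomposition`:
# helpers towards `stub_typeIIRegion` — Type-I sums with monotone weights (Abel summation; FM Lemma 7.8 (ii))

K. Ford, J. Maynard, arXiv:2407.14368v1, Lemma 7.8 (ii) (p. 29–30): if `w` satisfies (I) then the Type-I sums
twisted by the weight `log f / log x` obey the same bound up to a factor `2`:
"partial summation gives `∑_{a<f≤b} w_{fd} log f = (log b) ∑_{a<f≤b} w_{df} − ∫_a^b t⁻¹ ∑_{a<f≤t} w_{df} dt`,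
therefore `sup_I |∑_{f∈I} w_{fd} log f| ≤ 2 (log x) sup_I |∑_{f∈I} w_{fd}|`."
We prove the discrete form for an ARBITRARY weight `c_d(f)` that is monotone in `f` with `0 ≤ c ≤ 1`
(`typeI_monotone_weight_sum_le`: the Type-I sum with weights is `≤ 2x/(log x)^B`), by Abel summation
(`abs_sum_Icc_mul_le_of_monotone`, from Mathlib's `Finset.sum_range_by_parts`) and ONE application of (I) with the
maximising prefix intervals; and deduce Lemma 7.8 (ii) for `r = 1` (`typeI_log_weight_sum_le`, weight
`log f / log x`, which is `≤ 1` on the window `d f ≤ x`). The `sup` over intervals is rendered, as in the tree's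
`FordMaynard.TypeI`, by an arbitrary assignment `d ↦ I(d)`.
Def-free. Nothing here proves anything about the Parity summit.
-/

open Finset

namespace Summit.Parity.GeneralizedHardyLittlewood.FordMaynardSieveConst01651SieveConst01651

/-- **Abel summation bound.** For `g, c : ℕ → ℝ` with `c` monotone, `0 ≤ c a` and `c b ≤ 1`: if every prefix sum
`|∑_{a ≤ f ≤ k} g(f)|`, `a ≤ k ≤ b`, is at most `M ≥ 0`, then `|∑_{a ≤ f ≤ b} g(f) c(f)| ≤ 2M`. [folklore] -/
theorem abs_sum_Icc_mul_le_of_monotone (a b : ℕ) (g c : ℕ → ℝ) (hmono : Monotone c) (hca : 0 ≤ c a)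
    (hcb : c b ≤ 1) {M : ℝ} (hM0 : 0 ≤ M) (hM : ∀ k ∈ Icc a b, |∑ f ∈ Icc a k, g f| ≤ M) :
    |∑ f ∈ Icc a b, g f * c f| ≤ 2 * M := by
  rcases lt_or_ge b a with hba | hab
  · rw [Finset.Icc_eq_empty (not_le.mpr hba), Finset.sum_empty, abs_zero]
    linarith
  -- reindex over `range n`, `n = b + 1 - a`
  set n : ℕ := b + 1 - a with hn
  have hn1 : 1 ≤ n := by omega
  have hbn : a + (n - 1) = b := by omega
  have hIcc : ∀ k : ℕ, ∑ f ∈ Icc a k, g f = ∑ i ∈ range (k + 1 - a), g (a + i) := by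
    intro k
    rw [← Finset.Ico_add_one_right_eq_Icc, Finset.sum_Ico_eq_sum_range]
  have hS : ∑ f ∈ Icc a b, g f * c f = ∑ i ∈ range n, c (a + i) • g (a + i) := by
    rw [← Finset.Ico_add_one_right_eq_Icc, Finset.sum_Ico_eq_sum_range]
    refine Finset.sum_congr rfl fun i _ => ?_
    rw [smul_eq_mul, mul_comm]
  rw [hS, Finset.sum_range_by_parts]
  -- prefix sums over `range m`, `1 ≤ m ≤ n`, are prefix sums over `Icc a (a + m - 1)`
  have hpre : ∀ m : ℕ, 1 ≤ m → m ≤ n → |∑ j ∈ range m, g (a + j)| ≤ M := by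
    intro m hm1 hmn
    have h := hM (a + m - 1) (by rw [Finset.mem_Icc]; omega)
    rw [hIcc] at h
    have : a + m - 1 + 1 - a = m := by omega
    rwa [this] at h
  have h1 : |c (a + (n - 1)) • ∑ i ∈ range n, g (a + i)| ≤ c b * M := by
    rw [hbn, smul_eq_mul, abs_mul, abs_of_nonneg (hca.trans (hmono (by omega : a ≤ b)))]
    exact mul_le_mul_of_nonneg_left (hpre n hn1 le_rfl) (hca.trans (hmono (by omega : a ≤ b)))
  have h2 : |∑ i ∈ range (n - 1), (c (a + (i + 1)) - c (a + i)) • ∑ j ∈ range (i + 1), g (a + j)|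
      ≤ (c b - c a) * M := by
    calc |∑ i ∈ range (n - 1), (c (a + (i + 1)) - c (a + i)) • ∑ j ∈ range (i + 1), g (a + j)|
        ≤ ∑ i ∈ range (n - 1), |(c (a + (i + 1)) - c (a + i)) • ∑ j ∈ range (i + 1), g (a + j)| :=
          Finset.abs_sum_le_sum_abs _ _
      _ ≤ ∑ i ∈ range (n - 1), (c (a + (i + 1)) - c (a + i)) * M := by
          refine Finset.sum_le_sum fun i hi => ?_
          rw [Finset.mem_range] at hi
          have hdiff : 0 ≤ c (a + (i + 1)) - c (a + i) := sub_nonneg.mpr (hmono (by omega))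
          rw [smul_eq_mul, abs_mul, abs_of_nonneg hdiff]
          exact mul_le_mul_of_nonneg_left (hpre (i + 1) (by omega) (by omega)) hdiff
      _ = (c b - c a) * M := by
          rw [← Finset.sum_mul, Finset.sum_range_sub (fun i => c (a + i)), hbn, add_zero]
  calc |c (a + (n - 1)) • ∑ i ∈ range n, g (a + i) -
        ∑ i ∈ range (n - 1), (c (a + (i + 1)) - c (a + i)) • ∑ j ∈ range (i + 1), g (a + j)|
      ≤ |c (a + (n - 1)) • ∑ i ∈ range n, g (a + i)| +
        |∑ i ∈ range (n - 1), (c (a + (i + 1)) - c (a + i)) • ∑ j ∈ range (i + 1), g (a + j)| :=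
        abs_sub _ _
    _ ≤ c b * M + (c b - c a) * M := add_le_add h1 h2
    _ ≤ 2 * M := by nlinarith

/-- **Type-I sums with monotone weights** (the mechanism of Ford–Maynard Lemma 7.8 (ii)): if `w` satisfies (I) at
level `x^γ` with exponent `B`, then for every family of weights `c_d : ℕ → ℝ`, each monotone with `0 ≤ c_d ≤ 1`,
and every assignment of intervals `d ↦ I(d)`,
`∑_{d ≤ x^γ} τ(d)^B |∑_{f ∈ I(d), x/2 < d f ≤ x} w(d f) c_d(f)| ≤ 2x/(log x)^B`.
[cite: FordMaynard2024PrimeSieves, Lemma 7.8 (ii) (partial summation step)] -/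
theorem typeI_monotone_weight_sum_le {w : ℕ → ℝ} {x γ B : ℝ}
    (hI : Literature.Barriers.Parity.FordMaynard.TypeI w x γ B) (c : ℕ → ℕ → ℝ)
    (hmono : ∀ d, Monotone (c d)) (hc0 : ∀ d f, 0 ≤ c d f) (hc1 : ∀ d f, c d f ≤ 1) (I : ℕ → ℕ × ℕ) :
    ∑ d ∈ Icc 1 ⌊x ^ γ⌋₊, ((d.divisors.card : ℝ) ^ B) *
        |∑ f ∈ (Icc (I d).1 (I d).2).filter (fun f : ℕ => x / 2 < (d * f : ℝ) ∧ (d * f : ℝ) ≤ x),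
          w (d * f) * c d f| ≤ 2 * (x / Real.log x ^ B) := by
  classical
  -- prefix Type-I sums and their maximisers
  set A : ℕ → ℕ → ℝ := fun d k =>
    |∑ f ∈ (Icc (I d).1 k).filter (fun f : ℕ => x / 2 < (d * f : ℝ) ∧ (d * f : ℝ) ≤ x), w (d * f)| with hA
  have hmax : ∀ d : ℕ, ∃ k : ℕ, ∀ k' ∈ Icc (I d).1 (I d).2, A d k' ≤ A d k := by
    intro d
    by_cases h : (Icc (I d).1 (I d).2).Nonempty
    · obtain ⟨k, _, hk⟩ := Finset.exists_max_image _ (A d) h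
      exact ⟨k, hk⟩
    · exact ⟨0, fun k' hk' => (h ⟨k', hk'⟩).elim⟩
  choose ks hks using hmax
  -- per `d`: Abel summation against the extended sequence `g(f) = 𝟙[window] w(d f)`
  have hd : ∀ d : ℕ, ((d.divisors.card : ℝ) ^ B) *
        |∑ f ∈ (Icc (I d).1 (I d).2).filter (fun f : ℕ => x / 2 < (d * f : ℝ) ∧ (d * f : ℝ) ≤ x),
          w (d * f) * c d f| ≤ ((d.divisors.card : ℝ) ^ B) * (2 * A d (ks d)) := by
    intro d
    refine mul_le_mul_of_nonneg_left ?_ (Real.rpow_nonneg (Nat.cast_nonneg _) _)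
    set g : ℕ → ℝ := fun f => if x / 2 < (d * f : ℝ) ∧ (d * f : ℝ) ≤ x then w (d * f) else 0 with hg
    have hfilt : ∀ k : ℕ, ∑ f ∈ (Icc (I d).1 k).filter (fun f : ℕ => x / 2 < (d * f : ℝ) ∧ (d * f : ℝ) ≤ x),
        w (d * f) = ∑ f ∈ Icc (I d).1 k, g f := by
      intro k; rw [Finset.sum_filter]
    have hfilt' : ∑ f ∈ (Icc (I d).1 (I d).2).filter (fun f : ℕ => x / 2 < (d * f : ℝ) ∧ (d * f : ℝ) ≤ x),
        w (d * f) * c d f = ∑ f ∈ Icc (I d).1 (I d).2, g f * c d f := by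
      rw [Finset.sum_filter]
      refine Finset.sum_congr rfl fun f _ => ?_
      simp only [hg]
      split_ifs <;> simp
    rw [hfilt']
    refine abs_sum_Icc_mul_le_of_monotone _ _ g (c d) (hmono d) (hc0 d _) (hc1 d _) (abs_nonneg _) ?_
    intro k hk
    have := hks d k hk
    simp only [hA] at this
    rwa [hfilt k] at this
  -- sum over `d` and apply (I) once, with the intervals `[I(d).1, k_d]`
  have hTI := hI (fun d => ((I d).1, ks d))
  calc ∑ d ∈ Icc 1 ⌊x ^ γ⌋₊, ((d.divisors.card : ℝ) ^ B) *
          |∑ f ∈ (Icc (I d).1 (I d).2).filter (fun f : ℕ => x / 2 < (d * f : ℝ) ∧ (d * f : ℝ) ≤ x),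
            w (d * f) * c d f|
      ≤ ∑ d ∈ Icc 1 ⌊x ^ γ⌋₊, ((d.divisors.card : ℝ) ^ B) * (2 * A d (ks d)) := Finset.sum_le_sum fun d _ => hd d
    _ = 2 * ∑ d ∈ Icc 1 ⌊x ^ γ⌋₊, ((d.divisors.card : ℝ) ^ B) * A d (ks d) := by
        rw [Finset.mul_sum]
        refine Finset.sum_congr rfl fun d _ => ?_
        ring
    _ ≤ 2 * (x / Real.log x ^ B) := by
        refine mul_le_mul_of_nonneg_left ?_ (by norm_num)
        exact hTI

/-- **Ford–Maynard, Lemma 7.8 (ii), `r = 1`**: if `w` satisfies (I) at level `x^γ` with exponent `B` and `x > 1`,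
then for every assignment of intervals `d ↦ I(d)`,
`∑_{d ≤ x^γ} τ(d)^B |∑_{f ∈ I(d), x/2 < d f ≤ x} w(d f) (log f / log x)| ≤ 2x/(log x)^B`
(on the window `d f ≤ x`, `d ≥ 1`, the weight `log f / log x` lies in `[0, 1]` and is monotone in `f`).
[cite: FordMaynard2024PrimeSieves, Lemma 7.8 (ii)] -/
theorem typeI_log_weight_sum_le {w : ℕ → ℝ} {x γ B : ℝ}
    (hI : Literature.Barriers.Parity.FordMaynard.TypeI w x γ B) (hx : 1 < x) (I : ℕ → ℕ × ℕ) :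
    ∑ d ∈ Icc 1 ⌊x ^ γ⌋₊, ((d.divisors.card : ℝ) ^ B) *
        |∑ f ∈ (Icc (I d).1 (I d).2).filter (fun f : ℕ => x / 2 < (d * f : ℝ) ∧ (d * f : ℝ) ≤ x),
          w (d * f) * (Real.log f / Real.log x)| ≤ 2 * (x / Real.log x ^ B) := by
  have hlogx : 0 < Real.log x := Real.log_pos hx
  -- the clipped weight `min (log f / log x) 1`: monotone, in `[0, 1]`, equal to `log f / log x` on the window
  set c : ℕ → ℕ → ℝ := fun _ f => min (Real.log f / Real.log x) 1 with hc
  have hmono : ∀ d, Monotone (c d) := by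
    intro d f f' hff'
    simp only [hc]
    refine min_le_min ?_ le_rfl
    refine div_le_div_of_nonneg_right ?_ hlogx.le
    rcases Nat.eq_zero_or_pos f with rfl | hf
    · rw [Nat.cast_zero, Real.log_zero]; exact Real.log_natCast_nonneg _
    · exact Real.log_le_log (by exact_mod_cast hf) (by exact_mod_cast hff')
  have hc0 : ∀ d f, 0 ≤ c d f := fun d f =>
    le_min (div_nonneg (Real.log_natCast_nonneg _) hlogx.le) zero_le_one
  have hc1 : ∀ d f, c d f ≤ 1 := fun d f => min_le_right _ _
  have h := typeI_monotone_weight_sum_le hI c hmono hc0 hc1 I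
  refine le_trans (le_of_eq ?_) h
  refine Finset.sum_congr rfl fun d hd => ?_
  rw [Finset.mem_Icc] at hd
  congr 2
  refine Finset.sum_congr rfl fun f hf => ?_
  rw [Finset.mem_filter] at hf
  obtain ⟨_, _, hfx⟩ := hf
  simp only [hc]
  congr 1
  refine (min_eq_left ?_).symm
  rw [div_le_one hlogx]
  rcases Nat.eq_zero_or_pos f with rfl | hfpos
  · rw [Nat.cast_zero, Real.log_zero]; exact hlogx.le
  refine Real.log_le_log (by exact_mod_cast hfpos) ?_
  have hd1 : (1 : ℝ) ≤ d := by exact_mod_cast hd.1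
  have hf0 : (0 : ℝ) ≤ f := Nat.cast_nonneg _
  nlinarith

end Summit.Parity.GeneralizedHardyLittlewood.FordMaynardSieveConst01651SieveConst01651
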